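import Literature.AlgebraicGeometry.Motives.HodgeStructureEndAlgCentralizerInvolutionBlocks
import HarnessLib

/-!
# Milne 1999 §2, type IV on points: COMPATIBLE splittings of a conjugate pair of blocks — from a splitting
# `ρ : M_ι(K) → End_K(V_{K,τₛ})` of `E_φ ⊗ K` on `V_{K,τₛ}`, `M ↦ (ρ(Mᵀ))ᵀ` is a splitting on the partner block `V_{K,τₛ∘σ}`
# under which the Rosati involution is `(α, β) ↦ (βᵗʳ, αᵗʳ)` ("there exist compatible isomorphisms `E_σ → Ē`,
# `(V_σ, φ_σ) → (V̄, φ̄)`, the first of which carries the Rosati involution on `E_σ` into the involution `†` on `Ē`")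

[topic AlgebraicGeometry/Motives]

Layer `Literature/AlgebraicGeometry/Motives`, lane `lit-hodgefound` (Track 2 foundations library; seat `lit-hodgefound-p34`,
generation 22, self-proposed row g22-#6). Milne's type IV computation uses, for each embedding `σ` of the totally real field,
an isomorphism `E_σ = E ⊗_{F,σ} k^al → Ē = M_d(k^al) × M_d(k^al)` COMPATIBLE with the involutions: the Rosati involution on `E_σ`
and `(α, β)† = (βᵗʳ, αᵗʳ)` on `Ē` (p. 651). On `K`-points, on the abstract polarized `ℚ`-Hodge structure with a number field `F`
acting centrally (`hcent`) and the Rosati condition `Q(ι(a)v, w) = Q(v, ι(σa)w)`, the two factors of `Ē` act on the two blocks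
`V_{K,τₛ}`, `V_{K,τₛ∘σ}` of a conjugate pair, a "splitting" of a block is a unital `ρ : M_ι(K) →ₐ[K] End_K(V_{K,χ})` whose image
is the `K`-span of the restricted operators `a_K|V_{K,χ}` (FILE `Motives/HodgeStructureEndActionCentralBlocks`, where such
`ρ` are shown to EXIST over an algebraically closed `K`), and the involution acts on blocks by the transpose `f ↦ fᵀ` across the
perfect pairing `Q_K : V_{K,τₛ} × V_{K,τₛ∘σ} → K` (`Motives/HodgeStructureEndAlgCentralizerInvolutionBlocks`:
`Polarization.blockTranspose`, `c†|V_{K,τₛ∘σ} = (c|V_{K,τₛ})ᵀ`, `(a_K|V_{K,τₛ})ᵀ = (a†)_K|V_{K,τₛ∘σ}`). This file builds, from a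
splitting `ρ` of `V_{K,τₛ}`, the COMPATIBLE splitting `ρ^† : M ↦ (ρ(Mᵀ))ᵀ` of `V_{K,τₛ∘σ}` and proves that it is one
(its image is the `K`-span of the `a_K|V_{K,τₛ∘σ}`) and that under `(ρ, ρ^†)` the involution is matrix transposition with the
factors swapped. Definitions WITH BODIES + theorems, no named fact (net debt `0`).

## The source, verbatim

J. S. Milne, *Lefschetz classes on abelian varieties*, Duke Math. J. **96** (1999) 639–675 [Milne1999LefschetzClasses]
(held `paper:doi-10-1215-s0012-7094-99-09620-5`; Duke page = folio + 638), §2 pp. 650–651 (p0012 L70 – p0013 L56):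
* "Let `V₂ = V₁^∨`. It has a natural structure of a right `M_d(k^al)`-module, which we turn into a left module structure by using
  the involution `α ↦ αᵗʳ`. The bilinear form `(x₁, x₂) ↦ φ₀(x₁, x₂) = x₂(x₁) : V₁ × V₂ → k` has the property that
  `φ₀(αx₁, x₂) = φ₀(x₁, αᵗʳx₂)`. Set: `V̄ = V₁ ⊕ V₂`, `Ē = M_d(k^al) × M_d(k^al)`, `(α, β)† = (βᵗʳ, αᵗʳ)` […] Let `(α, β) ∈ Ē`
  act on `V̄` according to the rule: `(α, β)(x₁, x₂) = (αx₁, βx₂)`. Then `†` is an involution on `Ē` […] and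
  `φ̄(αx̄, ȳ) = φ̄(x̄, α†ȳ)`, all `α ∈ Ē`, `x̄, ȳ ∈ V̄`."
* "Using Remarks 2.2, 2.3, and 2.4, we find that, for each `σ`, there exist compatible isomorphisms `E_σ → Ē`,
  `(V_σ, φ_σ) → (V̄, φ̄)`, the first of which carries the Rosati involution on `E_σ` into the involution `†` on `Ē`".

## What is PROVED

* §1 `Polarization.blockTranspose_zero/_add/_smul` and DEF `Polarization.blockTransposeLinear` (the block transpose as a
  `K`-linear map; `_apply`).
* §2 DEF **`Polarization.transposeSplitting … s ρ : M_ι(K) →ₐ[K] End_K(V_{K,τₛ∘σ})`**, `M ↦ (ρ(Mᵀ))ᵀ` (an ALGEBRA hom: two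
  anti-homomorphisms compose), `transposeSplitting_apply`, **`Polarization.blockTranspose_splitting_apply`**
  (`(ρ M)ᵀ = ρ^†(Mᵀ)`: under `(ρ, ρ^†)` the involution is `(α, β) ↦ (βᵗʳ, αᵗʳ)`), and
  **`Polarization.span_blockOp_eq_range_transposeSplitting`**: if `K·{a_K|V_{K,τₛ}} = ρ(M_ι(K))` then
  `K·{a_K|V_{K,τₛ∘σ}} = ρ^†(M_ι(K))` — `ρ^†` IS a splitting of the partner block (the `a ↦ a†` bijection of `E_φ` and
  `(a_K|V_{K,τₛ})ᵀ = (a†)_K|V_{K,τₛ∘σ}`).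
* §3 over an algebraically closed `K`, for `E_φ` simple with centre exactly the central `ι(F)`:
  **`Polarization.exists_compatible_splittings`** — for every `s` there are `d ≥ 1` (`d²·[F:ℚ] = dim_ℚ E_φ`) and a splitting `ρ`
  of `V_{K,τₛ}` such that `ρ^†` is a splitting of `V_{K,τₛ∘σ}` (FILE 1's Wedderburn existence + §2).

NOT here (honest): the transport of the corner/Morita identifications `C_σ ≃ End_K(eV_σ)` along `(ρ, ρ^†)` to an explicit
"transpose of matrices" formula for `†` on `∏ₜ M_m(K)` (it needs a choice of dual bases of the two corners); the form `φ̄` on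
`V̄` (the compatibility of `(V_σ, φ_σ) → (V̄, φ̄)`); positivity. HC is NOT proved; nothing here claims a case of the Hodge conjecture.

## References

* [Milne1999LefschetzClasses] J. S. Milne, *Lefschetz classes on abelian varieties*, Duke Math. J. 96 (1999) 639–675 — §2
  pp. 650–651 (type IV: `Ē`, `(α, β)† = (βᵗʳ, αᵗʳ)`, "compatible isomorphisms `E_σ → Ē`").
* [Deligne1982HodgeCycles] P. Deligne, *Hodge cycles on abelian varieties*, LNM 900 (1982) — §4 (decomposition along the action
  of a CM field; Lemma 4.6).
-/

noncomputable section

open scoped TensorProduct Matrix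
open Function Module

namespace Literature.AlgebraicGeometry.Motives

namespace HodgeStructure

universe u uK

variable {V : Type u} [AddCommGroup V] [Module ℚ V] {n : ℤ} {H : HodgeStructure V n}
variable {F : Type*} [Field F] [NumberField F]
variable (K : Type uK) [Field K] [Algebra ℚ K] (A : EndAction H F) {S : Type*} (τ : S → (F →ₐ[ℚ] K))
variable (Q : Polarization H) (σ : F ≃ₐ[ℚ] F)

variable [Fintype S] [Module.Finite ℚ V] (κ : S → S)
variable (hτ : Injective τ) (hcard : Fintype.card S = finrank ℚ F)
  (hros : ∀ a v w, Q.form (A.ι a v) w = Q.form v (A.ι (σ a) w)) (hσ : ∀ a, σ (σ a) = a)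
  (hκ : ∀ s, τ (κ s) = (τ s).comp (σ : F →ₐ[ℚ] F))

/-! ## §1 The block transpose is `K`-linear -/

include hτ hcard hros hσ hκ in
/-- `0ᵀ = 0` on blocks. [cite: Milne1999LefschetzClasses, §2 p. 650 L74 ("φ₀(αx₁, x₂) = φ₀(x₁, αᵗʳx₂)")] -/
theorem Polarization.blockTranspose_zero (s : S) : Q.blockTranspose K A τ σ κ hτ hcard hros hσ hκ s 0 = 0 :=
  (Q.blockTranspose_unique K A τ σ κ hτ hcard hros hσ hκ s fun x y => by
    rw [LinearMap.zero_apply, LinearMap.zero_apply, Submodule.coe_zero, Submodule.coe_zero, map_zero, map_zero,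
      LinearMap.zero_apply]).symm

include hτ hcard hros hσ hκ in
/-- `(f + g)ᵀ = fᵀ + gᵀ` on blocks. [cite: Milne1999LefschetzClasses, §2 p. 650 L74] -/
theorem Polarization.blockTranspose_add (s : S) (f g : A.BlockEnd K (τ s)) :
    Q.blockTranspose K A τ σ κ hτ hcard hros hσ hκ s (f + g) =
      Q.blockTranspose K A τ σ κ hτ hcard hros hσ hκ s f + Q.blockTranspose K A τ σ κ hτ hcard hros hσ hκ s g :=
  (Q.blockTranspose_unique K A τ σ κ hτ hcard hros hσ hκ s fun x y => by
    rw [LinearMap.add_apply, LinearMap.add_apply, Submodule.coe_add, Submodule.coe_add, map_add, map_add,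
      LinearMap.add_apply, Q.baseChange_form_apply_blockTranspose K A τ σ κ hτ hcard hros hσ hκ,
      Q.baseChange_form_apply_blockTranspose K A τ σ κ hτ hcard hros hσ hκ]).symm

include hτ hcard hros hσ hκ in
/-- `(c f)ᵀ = c fᵀ` on blocks. [cite: Milne1999LefschetzClasses, §2 p. 650 L74] -/
theorem Polarization.blockTranspose_smul (s : S) (c : K) (f : A.BlockEnd K (τ s)) :
    Q.blockTranspose K A τ σ κ hτ hcard hros hσ hκ s (c • f) = c • Q.blockTranspose K A τ σ κ hτ hcard hros hσ hκ s f :=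
  (Q.blockTranspose_unique K A τ σ κ hτ hcard hros hσ hκ s fun x y => by
    rw [LinearMap.smul_apply, LinearMap.smul_apply, Submodule.coe_smul, Submodule.coe_smul, map_smul, LinearMap.map_smul₂,
      Q.baseChange_form_apply_blockTranspose K A τ σ κ hτ hcard hros hσ hκ]).symm

include hτ hcard hros hσ hκ in
/-- **The block transpose as a `K`-linear map** `End_K(V_{K,τₛ}) →ₗ[K] End_K(V_{K,τₛ∘σ})`. [cite: Milne1999LefschetzClasses, §2 p. 650 L70–L74] -/
def Polarization.blockTransposeLinear (s : S) : A.BlockEnd K (τ s) →ₗ[K] A.BlockEnd K ((τ s).comp (σ : F →ₐ[ℚ] F)) where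
  toFun := Q.blockTranspose K A τ σ κ hτ hcard hros hσ hκ s
  map_add' := Q.blockTranspose_add K A τ σ κ hτ hcard hros hσ hκ s
  map_smul' := Q.blockTranspose_smul K A τ σ κ hτ hcard hros hσ hκ s

include hτ hcard hros hσ hκ in
/-- Unfolding. [cite: Milne1999LefschetzClasses, §2 p. 650 L70–L74] -/
@[simp] theorem Polarization.blockTransposeLinear_apply (s : S) (f : A.BlockEnd K (τ s)) :
    Q.blockTransposeLinear K A τ σ κ hτ hcard hros hσ hκ s f = Q.blockTranspose K A τ σ κ hτ hcard hros hσ hκ s f :=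
  rfl

/-! ## §2 The compatible splitting `ρ^† : M ↦ (ρ(Mᵀ))ᵀ` of the partner block -/

section Compatible

variable {ι : Type*} [Fintype ι] [DecidableEq ι]

include hτ hcard hros hσ hκ in
/-- **The compatible splitting `ρ^†(M) = (ρ(Mᵀ))ᵀ`** of the partner block `V_{K,τₛ∘σ}` built from a splitting `ρ` of
`V_{K,τₛ}`: an algebra homomorphism `M_ι(K) →ₐ[K] End_K(V_{K,τₛ∘σ})` (matrix transposition and the block transpose are both
anti-multiplicative) — Milne's second factor of `Ē = M_d × M_d` acting on `V₂ = V₁^∨` "by using the involution `α ↦ αᵗʳ`".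
[cite: Milne1999LefschetzClasses, §2 p. 650 L70–L74 and p. 651 L5–L12 ("(α, β)(x₁, x₂) = (αx₁, βx₂)")] -/
def Polarization.transposeSplitting (s : S) (ρ : Matrix ι ι K →ₐ[K] A.BlockEnd K (τ s)) :
    Matrix ι ι K →ₐ[K] A.BlockEnd K ((τ s).comp (σ : F →ₐ[ℚ] F)) where
  toFun M := Q.blockTranspose K A τ σ κ hτ hcard hros hσ hκ s (ρ Mᵀ)
  map_one' := by rw [Matrix.transpose_one, map_one, Q.blockTranspose_one K A τ σ κ hτ hcard hros hσ hκ]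
  map_mul' M N := by rw [Matrix.transpose_mul, map_mul, Q.blockTranspose_mul K A τ σ κ hτ hcard hros hσ hκ]
  map_zero' := by rw [Matrix.transpose_zero, map_zero, Q.blockTranspose_zero K A τ σ κ hτ hcard hros hσ hκ]
  map_add' M N := by rw [Matrix.transpose_add, map_add, Q.blockTranspose_add K A τ σ κ hτ hcard hros hσ hκ]
  commutes' c := by
    rw [Algebra.algebraMap_eq_smul_one, Algebra.algebraMap_eq_smul_one, Matrix.transpose_smul, Matrix.transpose_one,
      map_smul, map_one, Q.blockTranspose_smul K A τ σ κ hτ hcard hros hσ hκ, Q.blockTranspose_one K A τ σ κ hτ hcard hros hσ hκ]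

include hτ hcard hros hσ hκ in
/-- Unfolding: `ρ^†(M) = (ρ(Mᵀ))ᵀ`. [cite: Milne1999LefschetzClasses, §2 p. 651 L5–L8] -/
theorem Polarization.transposeSplitting_apply (s : S) (ρ : Matrix ι ι K →ₐ[K] A.BlockEnd K (τ s)) (M : Matrix ι ι K) :
    Q.transposeSplitting K A τ σ κ hτ hcard hros hσ hκ s ρ M = Q.blockTranspose K A τ σ κ hτ hcard hros hσ hκ s (ρ Mᵀ) :=
  rfl

include hτ hcard hros hσ hκ in
/-- **Under `(ρ, ρ^†)` the involution is `(α, β) ↦ (βᵗʳ, αᵗʳ)`**: `(ρ M)ᵀ = ρ^†(Mᵀ)` — the block transpose of the operator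
with matrix `M` on `V_{K,τₛ}` is the operator with matrix `Mᵀ` on `V_{K,τₛ∘σ}`.
[cite: Milne1999LefschetzClasses, §2 p. 651 L5–L8 ("(α, β)† = (βᵗʳ, αᵗʳ)") and L49–L56 ("compatible isomorphisms E_σ → Ē … carries the Rosati involution on E_σ into the involution † on Ē")] -/
theorem Polarization.blockTranspose_splitting_apply (s : S) (ρ : Matrix ι ι K →ₐ[K] A.BlockEnd K (τ s)) (M : Matrix ι ι K) :
    Q.blockTranspose K A τ σ κ hτ hcard hros hσ hκ s (ρ M) = Q.transposeSplitting K A τ σ κ hτ hcard hros hσ hκ s ρ Mᵀ := by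
  rw [Polarization.transposeSplitting_apply, Matrix.transpose_transpose]

include hτ hcard hros hσ hκ in
/-- **`ρ^†` IS a splitting of the partner block**: if the image of `ρ` is the `K`-span of the `a_K|V_{K,τₛ}`, `a ∈ E_φ`, then
the image of `ρ^†` is the `K`-span of the `a_K|V_{K,τₛ∘σ}` (transpose the span: `(a_K|V_{K,τₛ})ᵀ = (a†)_K|V_{K,τₛ∘σ}` and
`a ↦ a†` is a bijection of `E_φ`). [cite: Milne1999LefschetzClasses, §2 p. 651 L49–L56 ("there exist compatible isomorphisms E_σ → Ē")] -/
theorem Polarization.span_blockOp_eq_range_transposeSplitting (hcent : ∀ a ∈ H.endAlg, ∀ f : F, a * A.ι f = A.ι f * a) (s : S)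
    (ρ : Matrix ι ι K →ₐ[K] A.BlockEnd K (τ s))
    (hρ : Submodule.span K (Set.range (A.blockOp K hcent (τ s))) = LinearMap.range ρ.toLinearMap) :
    Submodule.span K (Set.range (A.blockOp K hcent ((τ s).comp (σ : F →ₐ[ℚ] F)))) =
      LinearMap.range (Q.transposeSplitting K A τ σ κ hτ hcard hros hσ hκ s ρ).toLinearMap := by
  -- the image of `ρ^†` is the block transpose of the image of `ρ`
  have hT : LinearMap.range (Q.transposeSplitting K A τ σ κ hτ hcard hros hσ hκ s ρ).toLinearMap =
      (LinearMap.range ρ.toLinearMap).map (Q.blockTransposeLinear K A τ σ κ hτ hcard hros hσ hκ s) := by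
    ext g
    simp only [LinearMap.mem_range, AlgHom.toLinearMap_apply, Submodule.mem_map, Polarization.blockTransposeLinear_apply,
      Polarization.transposeSplitting_apply]
    constructor
    · rintro ⟨M, rfl⟩
      exact ⟨ρ Mᵀ, ⟨Mᵀ, rfl⟩, rfl⟩
    · rintro ⟨_, ⟨M, rfl⟩, rfl⟩
      exact ⟨Mᵀ, by rw [Matrix.transpose_transpose]⟩
  -- the span of the `a_K|V_{sσ}` is the block transpose of the span of the `a_K|V_s` (`a ↦ a†` is onto)
  have hadj : ∀ a : H.endAlg, ∃ b : H.endAlg, (⟨Q.adjoint (b : Module.End ℚ V), Q.adjoint_mem_endAlg b.2⟩ : H.endAlg) = a :=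
    fun a => ⟨⟨Q.adjoint (a : Module.End ℚ V), Q.adjoint_mem_endAlg a.2⟩,
      Subtype.ext (Polarization.adjoint_adjoint Q (a : Module.End ℚ V))⟩
  have hS : Set.range (A.blockOp K hcent ((τ s).comp (σ : F →ₐ[ℚ] F))) =
      Q.blockTransposeLinear K A τ σ κ hτ hcard hros hσ hκ s '' Set.range (A.blockOp K hcent (τ s)) := by
    ext g
    constructor
    · rintro ⟨a, rfl⟩
      obtain ⟨b, rfl⟩ := hadj a
      exact ⟨A.blockOp K hcent (τ s) b, ⟨b, rfl⟩,
        (A.blockTranspose_blockOp K τ Q σ κ hτ hcard hros hσ hκ hcent b s)⟩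
    · rintro ⟨_, ⟨b, rfl⟩, rfl⟩
      exact ⟨⟨Q.adjoint (b : Module.End ℚ V), Q.adjoint_mem_endAlg b.2⟩,
        (A.blockTranspose_blockOp K τ Q σ κ hτ hcard hros hσ hκ hcent b s).symm⟩
  rw [hT, ← hρ, Submodule.map_span, ← hS]

end Compatible

/-! ## §3 Over an algebraically closed `K`: compatible splittings of every conjugate pair EXIST -/

include hτ hcard hros hσ hκ in
/-- **Compatible splittings exist** (`K` algebraically closed, `E_φ` simple with centre exactly the central `ι(F)`): for every
`s` there are `d ≥ 1` with `d²·[F:ℚ] = dim_ℚ E_φ` and a splitting `ρ : M_d(K) →ₐ[K] End_K(V_{K,τₛ})` of `V_{K,τₛ}` whose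
compatible partner `ρ^†` is a splitting of `V_{K,τₛ∘σ}` — "for each `σ`, there exist compatible isomorphisms `E_σ → Ē`".
[cite: Milne1999LefschetzClasses, §2 p. 651 L49–L56] -/
theorem Polarization.exists_compatible_splittings [IsAlgClosed K] [IsSimpleRing H.endAlg]
    (hcent : ∀ a ∈ H.endAlg, ∀ f : F, a * A.ι f = A.ι f * a)
    (hcen : ∀ z ∈ H.endAlg, (∀ a ∈ H.endAlg, a * z = z * a) → z ∈ Set.range A.ι) (s : S) :
    ∃ d : ℕ, NeZero d ∧ d ^ 2 * finrank ℚ F = finrank ℚ H.endAlg ∧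
      ∃ ρ : Matrix (Fin d) (Fin d) K →ₐ[K] A.BlockEnd K (τ s),
        Submodule.span K (Set.range (A.blockOp K hcent (τ s))) = LinearMap.range ρ.toLinearMap ∧
          Submodule.span K (Set.range (A.blockOp K hcent ((τ s).comp (σ : F →ₐ[ℚ] F)))) =
            LinearMap.range (Q.transposeSplitting K A τ σ κ hτ hcard hros hσ hκ s ρ).toLinearMap := by
  obtain ⟨d, hd, hdim, ρ, hρ⟩ := A.exists_matrixAlgHom_span_blockOp_eq_range K hcent hcen (τ s)
  exact ⟨d, hd, hdim, ρ, hρ, Q.span_blockOp_eq_range_transposeSplitting K A τ σ κ hτ hcard hros hσ hκ hcent s ρ hρ⟩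

end HodgeStructure

end Literature.AlgebraicGeometry.Motives
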